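import Summits.QuantumFields.YangMills.Theorems.BalabanUVNodesN22AtRecordOfGenAnalyticNonexpansive

/-!
# BalabanUVNodes ∕ node N22 = NE9 — K3's `h9` ON ROAD 2 FROM A NON-EXPANSIVE ANALYTIC READING WITH THE LAST COUPLING CARRIED BY REAL-COUPLING SCHEMAS (schema-form twin of
# module J63 §1): the older-term side read through the analytic reading (AR) exactly as in J63, the last-coupling side DISPLAYED as module J62 §3's first- and second-order
# schemas `hGt ∕ hG2last` of the generator AT REAL WINDOW COUPLINGS (generic letters `lam ≤ ℓ₁`, `lam₂ ≤ ℓ₂`) instead of the sector datum `O V hholS hbdS` on the generator's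
# complex-coupling values — so that a consumer may supply the schemas from ANY holomorphic continuation agreeing with the generator at real couplings (module J85: def-W1's
# continued terms)

Cell `pub-ymgap`, HUMAN RULING D-0062 (Track A), R134 seat `pub-ymgap-dag-n22-c` (strategy s1: «the history-Lipschitz estimate (2.40)–(2.41) p. 21 of [II] on the W1 object»), generation
20, module J84A.  THEOREMS ONLY (no `def`, no `sorry`, standard axioms); `--kind proof --supports stmt-QuantumFields-27366 --as helper` (K3⁸ `SpineGivenEndpointR13SepCoPHV`), COUNT-NEUTRAL.
Imports this lane's module J63 `…N22AtRecordOfGenAnalyticNonexpansive` (through it J62 `…GenAnalyticReadingNonexpansive` §3 `termSecondDiffAt_box_truncRun_toClusterTower_of_analyticReadingNonexpansive`,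
J60 §0 `outputBound_truncRun_toClusterTower_of_analyticReading`, J46 `…_of_kernelStepRate_termSecondDiff_outputBound`).  Nothing re-declared; J63 §1's proof with the two J59 §2 conversions
(`genT1last ∕ genT2last_of_lastSectorHolo`) left to the caller.

WHY.  Module J63 §1 (and every ROAD-2 edition composed on it: J66 §2, J68, J69–J79) took the last-coupling regularity as a SECTOR datum on the generator's OWN complex-coupling values
`z ↦ ((Gn K) k).E z old φ X` (`hholS`, centred bound `hbdS`) and converted it IN THE PROOF into J62 §3's real-coupling schemas.  At def-W1's term data the honest holomorphic object in
the last coupling is NOT the datum's raw complex-coupling display but def-W1's CONTINUED terms (`TermData214.continuedTF`, `Node00/HistoryTermDatum214WindowDilated` §4–§6; module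
J80A records why freezing the boxes of the raw display on the sector is consistent only with coupling-blind boxes), whose generator AGREES with `(𝔇 K).Gn` at real couplings only.
The schemas are statements at real couplings, hence transportable along such an agreement; the sector datum is not.  THIS FILE re-states J63 §1 with the schemas displayed:
`hGt : ‖(Gn K k).E ↑t old φ X − (Gn K k).E ↑t′ old φ X‖ ≤ e^{−κ_E d_{k+1}(X)}·lam K k·|t − t′|` (`lam ≤ ℓ₁`), `hG2last : ‖E(t+d) − 2E(t) + E(t−d)‖ ≤ e^{−κ_E d}·lam₂ K k·d²` (`lam₂ ≤ ℓ₂`)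
on the class `Adm K k`, the table `sp K k X`, `t, t′, t ± d ∈ ]0, γ]`; the `C₉` row reads `M₂ = max ℓ₂ (64M_b c_w²ℓ₁²∕ϱ²∕(1 − 4M_b c_w∕ϱ))` (J62 §3's uniform letter).  J63 §1 is the
instance `lam := B_qγ∕c_S`, `lam₂ := (6c_S² + 32c_S + 64)B_q∕c_S²` (J59 §2).
* §1 ★★★ `ne9_EA_objectsOfRecord₁₃_of_kernelStepRate_genAnalyticReadingLastSchemasNonexpansive` — binder diff vs J63 §1: `O V hcS hBq hballS hholS hbdS` OUT; `hGt hlam hℓ₁ hG2last hlam₂ hℓ₂`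
  IN ({lam lam₂ : ℕ → ℕ → ℝ}, {ℓ₁ ℓ₂ : ℝ} replace {c_S B_q}); `hC₉` at the generic `M₂`.
Displayed as in J63: N18's kernel step rate `h5` + (1.21) `hlim`; W1-20's law `hloc` at the run towers of `Gn`; the analytic reading (AR) of the older terms (`Pot ρA A`, (AR-fact) `hGA`,
(AR-holo) `hA hMbA`, (AR-adm) `hAdmr`, (AR-dom₁∕₂) `hρ₁ hρ₂`, age weights `haw hawcw`, non-expansive clause `4M_b c_w∕ϱ < 1`, (Adm-run) `hAdm`); term holomorphy through the readings
`hEhol`; chart data; numerics; standing rows (`ℓ.θ₅ ≤ ℓ.ω²`, `ℓ.κ ≤ δ₁ ≤ κ₅`, `0 < ℓ.ω`, `hC₉`).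

HONEST FRAMING (binding).  Count-neutral COMPOSITION of tree theorems BY NAME (J62 §3, J60 §0, J46); the schemas, the analytic reading, the law, the chart data, the numerics and every
other binder are DISPLAYED HYPOTHESES (GAPS G-ne9p2-5 ∕ G-t4-U3-1: [I] p. 263 «C^∞ … (or analytic)» — nothing quantitative in print); NO estimate of Bałaban's is proved or asserted.
N18, N10 and N22 are NOT discharged (typed 28∕28; count 7∕27 per dag-lead TABLE — N22 unchanged); K3⁸ OPEN and NOT claimed; NE9 ∕ NE5 NOT IN PRINT for d = 4; no count claim; one
finite 𝕋⁴ programme at fixed ε — R4 closes the CONDITIONAL rung `BalabanLadder.UV` only; NOTHING about the continuum limit, ℝ⁴, infinite volume, OS axioms, a mass gap or the Clay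
problem is proved or claimed.  References (TYPES only): [II] = Bałaban, CMP 116 (1988) (1.41) p. 11, (2.13) p. 14, Lemma 3 (2.38) p. 20, (2.39)–(2.41) p. 21; [I] = CMP 109 (1987)
(0.23)–(0.24) pp. 256–257, Thm 1 p. 259, (1.17)–(1.18) p. 263, p. 266; Kotecký–Preiss, CMP 103 (1986) Thm p. 492; King, CMP 102 (1986) Lemma 4.5 (4.38).
-/

noncomputable section

open Set Metric
open scoped BigOperators

namespace YMDAG.N22.KernelFading

open Literature.MathematicalPhysics.QuantumFieldTheory.Balaban1983to89
open Literature.MathematicalPhysics.QuantumFieldTheory.Balaban1983to89.T4Continuum (T4Family ULoop)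
open Literature.MathematicalPhysics.QuantumFieldTheory.Balaban1983to89.T4OutputRate (Window NE9)
open Literature.MathematicalPhysics.QuantumFieldTheory.Balaban1983to89.TreeLengthTorus (TPt)
open Literature.MathematicalPhysics.QuantumFieldTheory.Balaban1983to89.B12TreeDecay (K₀ kappa₀)
open Literature.MathematicalPhysics.QuantumFieldTheory.Balaban1983to89.B12Decay510 (delta1)
open Literature.MathematicalPhysics.QuantumFieldTheory.Balaban1983to89.B12Decay510Window (K₁)
open Literature.MathematicalPhysics.QuantumFieldTheory.Balaban1983to89.B12Decay510Torus (distCT nearT)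
open Literature.MathematicalPhysics.QuantumFieldTheory.Balaban1983to89.Node00 (Stage13Params Stage13HParams U3Letters₁₁ MatA)
open Literature.MathematicalPhysics.QuantumFieldTheory.Balaban1983to89.Node00.Sect2 (domSys domCount CPair)
open Literature.MathematicalPhysics.QuantumFieldTheory.Balaban1983to89.Node00.W1
open Literature.MathematicalPhysics.QuantumFieldTheory.Balaban1983to89.Node00.LocalizedSum17 (ReadingMaps Localizes17OfRecord₁₃)
open Literature.MathematicalPhysics.QuantumFieldTheory.Balaban1983to89.Node00.U3OfKernels (histPrefix objectsOfRecord₁₃)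
open Literature.MathematicalPhysics.QuantumFieldTheory.Balaban1983to89.Node00.U3KernelLetters (KernelStepRateOfRecord₁₃ PolLimitsExistOfRecord₁₃)
open YMDAG.UVSplit (N22At u3OfRecord₁₃ RateReading₁₃CoPH rateCarriersOfRecord₁₃CoPH)
open YMDAG.N22.AtKernels (n22At_rateCarriers_of_kernels_pin_of_ne9 n22At_u3OfRecord₁₃_objectsOfRecord₁₃_iff)
open YMDAG.N22.TermRecursion (genT1last_of_lastSectorHolo genT2last_of_lastSectorHolo outputBound_truncRun_toClusterTower_of_analyticReading
  termSecondDiffAt_box_truncRun_toClusterTower_of_analyticReadingNonexpansive)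

open scoped Matrix.Norms.L2Operator

variable (F : T4Family) (N : ℕ) [NeZero N] {𝔸 : Type} {M : ℕ}

/-! ## §1 ★★★ schema-form twin of `ne9_EA_objectsOfRecord₁₃_of_kernelStepRate_genAnalyticNonexpansive` -/

open Classical Finset in
/-- ★★★ **K3's `h9` ON ROAD 2 FROM A NON-EXPANSIVE ANALYTIC READING, LAST COUPLING BY REAL-COUPLING SCHEMAS** (schema-form twin of module J63 §1): N18's rate + (1.21) + W1-20's
law at the run towers of `Gn` + the analytic reading (AR) of the older terms (non-expansive, `4M_b c_w∕ϱ < 1`) + (Adm-run) + the DISPLAYED first-∕second-order last-coupling schemas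
`hGt` (`lam ≤ ℓ₁`) ∕ `hG2last` (`lam₂ ≤ ℓ₂`) of `Gn` at real window couplings + term holomorphy through the readings + chart data + rows (`C₉` at `M₂ = max ℓ₂ (64M_b c_w²ℓ₁²∕ϱ²∕(1−4M_bc_w∕ϱ))`)
⟹ `NE9 (EA 0) (Window γ) ℓ.κ ℓ.moduli`.  Proof = J63 §1's (J62 §3 + J60 §0 + J46) with the schemas passed through.  LOCATED (hypothesis form); N22 NOT discharged. [folklore] -/
theorem ne9_EA_objectsOfRecord₁₃_of_kernelStepRate_genAnalyticReadingLastSchemasNonexpansive (θ : Stage13Params F N) (ℓ : U3Letters₁₁) (hs : ℓ.Signs) (hγ : 0 < θ.γ)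
    (hlim : PolLimitsExistOfRecord₁₃ F N θ) {κ₅ C₅ : ℝ} (hC₅ : 0 ≤ C₅) (h5 : KernelStepRateOfRecord₁₃ F N θ κ₅ ℓ.θ₅ C₅)
    (m' : ℕ) (M : ℕ) [NeZero M] (hM : M = F.L ^ m')
    (Gn : (K : ℕ) → GenTower (F.P K) 𝔸 M) (emb : ReadingMaps F (MatA N) 𝔸)
    (hloc : Localizes17OfRecord₁₃ F N θ (fun K => truncRun K (toClusterTower (Gn K))) emb)
    (sp : (K k : ℕ) → (domSys (F.P K) M (k + 1)).Dom → Set (CPair (F.P K) 𝔸))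
    {κ κE δ₀ B₃ r R r₀ ϱ Mb cw ℓ₁ ℓ₂ : ℝ} {aw : ℕ → ℕ → ℕ → ℝ} {lam lam₂ : ℕ → ℕ → ℝ}
    (hκ₀ : kappa₀ (4 * 2 ^ 4) (2 * 4) ≤ κ / 2) (hδ₀ : 0 < δ₀) (hB₃ : 0 ≤ B₃) (hr : 0 < r) (hκE : κ ≤ κE)
    (Adm : (K k : ℕ) → OlderTerms (F.P K) 𝔸 M k → Prop)
    (hAdm : ∀ K, ∀ g ∈ Window θ.γ, ∀ k, Adm K k (olderOf (recTerm (Gn K) fun n => ((g n : ℝ) : ℂ)) k))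
    {Pot : ℕ → ℕ → Type*} [∀ K k, NormedAddCommGroup (Pot K k)] [∀ K k, NormedSpace ℂ (Pot K k)]
    (ρA : (K k : ℕ) → OlderTerms (F.P K) 𝔸 M k → Pot K k) (A : (K k : ℕ) → ℝ → CPair (F.P K) 𝔸 → (domSys (F.P K) M (k + 1)).Dom → Pot K k → ℂ)
    (hGA : ∀ (K k : ℕ), ∀ t ∈ Ioc (0 : ℝ) θ.γ, ∀ (old : OlderTerms (F.P K) 𝔸 M k), Adm K k old → ∀ (X : (domSys (F.P K) M (k + 1)).Dom), ∀ φ ∈ sp K k X,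
      ((Gn K) k).E ((t : ℝ) : ℂ) old φ X = A K k t φ X (ρA K k old))
    (hA : ∀ (K k : ℕ), ∀ t ∈ Ioc (0 : ℝ) θ.γ, ∀ (X : (domSys (F.P K) M (k + 1)).Dom), ∀ φ ∈ sp K k X, DifferentiableOn ℂ (A K k t φ X) (ball 0 R))
    (hMbA : ∀ (K k : ℕ), ∀ t ∈ Ioc (0 : ℝ) θ.γ, ∀ (X : (domSys (F.P K) M (k + 1)).Dom), ∀ φ ∈ sp K k X, ∀ p ∈ ball (0 : Pot K k) R,
      ‖A K k t φ X p‖ ≤ Mb * Real.exp (-(κE * (domSys (F.P K) M (k + 1)).dj X)))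
    (hAdmr : ∀ (K k : ℕ) (old : OlderTerms (F.P K) 𝔸 M k), Adm K k old → ‖ρA K k old‖ ≤ r₀)
    (hρ₁ : ∀ (K k : ℕ) (o o' : OlderTerms (F.P K) 𝔸 M k), Adm K k o → Adm K k o' → ∀ (B' : ℝ), 0 ≤ B' →
      (∀ (k' : ℕ) (hk' : k' < k) (Y : (domSys (F.P K) M (k' + 1)).Dom), ∀ φ' ∈ sp K k' Y,
        aw K k (k' + 1) * (Real.exp (κE * (domSys (F.P K) M (k' + 1)).dj Y) * ‖o ⟨k' + 1, Nat.succ_lt_succ hk'⟩ Y φ' - o' ⟨k' + 1, Nat.succ_lt_succ hk'⟩ Y φ'‖) ≤ B') →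
      ‖ρA K k o - ρA K k o'‖ ≤ B')
    (hρ₂ : ∀ (K k : ℕ) (o₁ o₂ o₃ : OlderTerms (F.P K) 𝔸 M k), Adm K k o₁ → Adm K k o₂ → Adm K k o₃ → ∀ (B' : ℝ), 0 ≤ B' →
      (∀ (k' : ℕ) (hk' : k' < k) (Y : (domSys (F.P K) M (k' + 1)).Dom), ∀ φ' ∈ sp K k' Y,
        aw K k (k' + 1) * (Real.exp (κE * (domSys (F.P K) M (k' + 1)).dj Y) *
          ‖o₁ ⟨k' + 1, Nat.succ_lt_succ hk'⟩ Y φ' - 2 * o₂ ⟨k' + 1, Nat.succ_lt_succ hk'⟩ Y φ' + o₃ ⟨k' + 1, Nat.succ_lt_succ hk'⟩ Y φ'‖) ≤ B') →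
      ‖ρA K k o₁ - (2 : ℂ) • ρA K k o₂ + ρA K k o₃‖ ≤ B')
    (haw : ∀ K k j, 0 ≤ aw K k j) (hawcw : ∀ K k j, aw K k j ≤ cw) (hC1 : 4 * Mb * cw / ϱ < 1)
    (hMb0 : 0 ≤ Mb) (hϱ : 0 < ϱ) (hR : r₀ + ϱ < R)
    (hGt : ∀ (K k : ℕ), ∀ t ∈ Ioc (0 : ℝ) θ.γ, ∀ t' ∈ Ioc (0 : ℝ) θ.γ, ∀ (old : OlderTerms (F.P K) 𝔸 M k), Adm K k old →
      ∀ (X : (domSys (F.P K) M (k + 1)).Dom), ∀ φ ∈ sp K k X,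
        ‖((Gn K) k).E ((t : ℝ) : ℂ) old φ X - ((Gn K) k).E ((t' : ℝ) : ℂ) old φ X‖ ≤ Real.exp (-(κE * (domSys (F.P K) M (k + 1)).dj X)) * (lam K k * |t - t'|))
    (hlam : ∀ K k, lam K k ≤ ℓ₁) (hℓ₁ : 0 ≤ ℓ₁)
    (hG2last : ∀ (K k : ℕ) (old : OlderTerms (F.P K) 𝔸 M k), Adm K k old → ∀ (t d : ℝ), 0 < d → t - d ∈ Ioc (0 : ℝ) θ.γ → t + d ∈ Ioc (0 : ℝ) θ.γ →
      ∀ (X : (domSys (F.P K) M (k + 1)).Dom), ∀ φ ∈ sp K k X,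
        ‖((Gn K) k).E ((t + d : ℝ) : ℂ) old φ X - 2 * ((Gn K) k).E ((t : ℝ) : ℂ) old φ X + ((Gn K) k).E ((t - d : ℝ) : ℂ) old φ X‖ ≤
          Real.exp (-(κE * (domSys (F.P K) M (k + 1)).dj X)) * (lam₂ K k * d ^ 2))
    (hlam₂ : ∀ K k, lam₂ K k ≤ ℓ₂) (hℓ₂ : 0 ≤ ℓ₂)
    (Ec : ℕ → ℕ → Type*) [∀ K k, NormedAddCommGroup (Ec K k)] [∀ K k, NormedSpace ℂ (Ec K k)]
    (ι : letI := θ.instVβ₁; letI := θ.instVβ₂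
      (K k : ℕ) → (domSys (F.P K) M (k + 1)).Dom → ((Fin (F.P K).d → Site (F.P K) (k + 1) → θ.Vβ) →L[ℝ] Ec K k))
    (Φ : (K k : ℕ) → (domSys (F.P K) M (k + 1)).Dom → Ec K k → CPair (F.P K) 𝔸)
    (U : (K k : ℕ) → (domSys (F.P K) M (k + 1)).Dom → Set (Ec K k)) (hU : ∀ K k X, IsOpen (U K k X)) (hrU : ∀ K k X, ball (0 : Ec K k) r ⊆ U K k X)
    (hEhol : ∀ g ∈ Window θ.γ, ∀ (K k : ℕ) (X : (domSys (F.P K) M (k + 1)).Dom),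
      DifferentiableOn ℂ (fun z => (truncRun K (toClusterTower (Gn K)) k).E (histPrefix g k) (Φ K k X z) X) (U K k X))
    (hΦemb : letI := θ.instVβ₁; letI := θ.instVβ₂
      ∀ (K k : ℕ) (X : (domSys (F.P K) M (k + 1)).Dom) (Bf : Fin (F.P K).d → Site (F.P K) (k + 1) → θ.Vβ),
        Φ K k X (ι K k X Bf) = emb K k (fun l t => NormedSpace.exp (θ.ρ8 (Bf l t))))
    (hΦsp : ∀ (K k : ℕ) (X : (domSys (F.P K) M (k + 1)).Dom), ∀ z ∈ ball (0 : Ec K k) r, Φ K k X z ∈ sp K k X)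
    (w : (K k : ℕ) → (domSys (F.P K) M (k + 1)).Dom → Site (F.P K) (k + 1) → ℝ) (hw₀ : ∀ K k X t, 0 ≤ w K k X t)
    (hw : letI := θ.instVβ₁; letI := θ.instVβ₂; letI := θ.instιβ
      ∀ (K k : ℕ) (X : (domSys (F.P K) M (k + 1)).Dom) (l : Fin (F.P K).d) (t : Site (F.P K) (k + 1)) (c : θ.ιβ),
        ‖ι K k X (Pi.single l (Pi.single t (θ.bV c)))‖ ≤ w K k X t)
    (htail : ∀ (K k : ℕ) (X : (domSys (F.P K) M (k + 1)).Dom) (t : Site (F.P K) (k + 1)),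
      let e : Site (F.P K) (k + 1) → TPt 4 (domCount (F.P K) M (k + 1) * M) := fun x i => (ZMod.cast (x i) : ZMod (domCount (F.P K) M (k + 1) * M))
      w K k X t ≤ B₃ * Real.exp (-δ₀ * distCT (domCount (F.P K) M (k + 1)) M (e t) (nearT (M := M) (e t) X)))
    (hκ₅ : delta1 δ₀ κ ((M : ℝ) * 4) ≤ κ₅)
    (hω : 0 < ℓ.ω) (hθω : ℓ.θ₅ ≤ ℓ.ω ^ 2) (hℓκ : ℓ.κ ≤ delta1 δ₀ κ ((M : ℝ) * 4))
    (hC₉ : (4 * (2 * C₅ / (1 - ℓ.θ₅) + 2 * ((16 * Mb * B₃ ^ 2 / r ^ 2) * Real.exp (delta1 δ₀ κ ((M : ℝ) * 4) * ((M : ℝ) * 4) * 3) * K₀ (4 * 2 ^ 4) (2 * 4) * K₁ 4 (δ₀ / 2))) / θ.γ +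
        ((16 * max ℓ₂ (64 * Mb * cw ^ 2 / ϱ ^ 2 * ℓ₁ ^ 2 / (1 - 4 * Mb * cw / ϱ)) * B₃ ^ 2 / r ^ 2) * Real.exp (delta1 δ₀ κ ((M : ℝ) * 4) * ((M : ℝ) * 4) * 3) * K₀ (4 * 2 ^ 4) (2 * 4) *
          K₁ 4 (δ₀ / 2)) * θ.γ / 2) / ℓ.ω ≤ ℓ.C₉) :
    NE9 ((objectsOfRecord₁₃ F N θ ℓ).EA 0) (Window θ.γ) ℓ.κ ℓ.moduli := by
  -- module J62 §3 at every torus with the DISPLAYED real-coupling schemas `hGt ∕ hG2last`; module J60 §0: the output bound from (AR) + (Adm-run)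
  have hM₂ : 0 ≤ max ℓ₂ (64 * Mb * cw ^ 2 / ϱ ^ 2 * ℓ₁ ^ 2 / (1 - 4 * Mb * cw / ϱ)) := hℓ₂.trans (le_max_left _ _)
  have hΔ := fun K => termSecondDiffAt_box_truncRun_toClusterTower_of_analyticReadingNonexpansive (Gn K) (sp K) (Adm K) (ρA K) (A K) hγ hϱ hR (hGA K) (hA K) (hMbA K)
    (hAdmr K) (hρ₁ K) (hρ₂ K) (haw K) (hawcw K) (hAdm K) (hGt K) (hlam K) hℓ₁ (hG2last K) (hlam₂ K) hℓ₂ hC1 K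
  exact ne9_EA_objectsOfRecord₁₃_of_kernelStepRate_termSecondDiff_outputBound F N θ ℓ hs hγ hlim hC₅ h5 m' M hM (fun K => truncRun K (toClusterTower (Gn K))) emb hloc sp
    hκ₀ hδ₀ hB₃ hr hM₂ hMb0 hκE hΔ
    (fun g hg K => outputBound_truncRun_toClusterTower_of_analyticReading (Gn K) (sp K) (Adm K) (ρA K) (A K) (by linarith) hMb0 (hGA K) (hMbA K) (hAdmr K) (hAdm K) K g hg)
    Ec ι Φ U hU hrU hEhol hΦemb hΦsp w hw₀ hw htail hκ₅ hω hθω hℓκ hC₉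

end YMDAG.N22.KernelFading

end
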